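import Literature.Barriers.CriticalPhenomena.PlaquetteWalkKissLoop
import HarnessLib

/-!
# Barrier catalogue (SAWScalingLimit): the KISS LOOP misses the rest of the walk's drawing («KISS LOOP SEPARATION»)

`Z → ∞` limit model of the printed Yang–Baxter weights [GlazmanManolescu2019, §1, eq. (1)]; the «RECTANGLE COEFFICIENT» line, TAIL LEMMA infrastructure
(b-engine-1 g25, DESIGN-next-g25 §2bis/§2ter), on top of `PlaquetteWalkKissLoop` (loop data + winding transport).

For a walk `γ` and ANY kiss pair `ta < tb` (`fc tb = fc ta`), every drawn piece of the walk OUTSIDE the index range `[ta, tb]` misses every closed edge of the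
kiss loop (no minimality hypothesis: at an earlier or later kiss the two arcs of one plaquette are the disjoint complementary diagonals):
★ `arcSeg_disjoint_kEdge_of_lt` / `crossSeg_disjoint_kEdge_of_lt` (the before-part: arcs `j < ta`, crossings `nth j`, `j < ta`),
★ `arcSeg_disjoint_kEdge_of_gt` / `crossSeg_disjoint_kEdge_of_gt` (the after-part: arcs `j > tb` — INCLUDING second visits of loop plaquettes, whose arcs are
the disjoint complementary diagonals — and crossings `nth j`, `j ≥ tb + 2`, plus the exit crossing `nth (tb + 1)`). Tools: the incidence lemmas of
`YangBaxterSAWExcursionJordan` (`eq_of_mem_crossSeg`, `eq_side_of_mem_crossSeg_arcSeg`, `eq_face_of_mem_arcSeg`, `straight_of_mem_arcSeg_arcSeg`) and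
mid-edge injectivity `nth_inj`. Consequence ★★ `windK_before_eq` / `windK_after_eq`: the winding number of the kiss loop is constant along the before-part
(`= windK (midPt a)`) and along the after-part (`= windK (midPt z)`).
[CourantRobbins1958, Ch. V Appendix §2] [AhlforsCA1979, Ch. 4 §2.1] [GlazmanManolescu2019 §1 Fig. 1, eq. (1)]
-/

noncomputable section

open Set Function Complex
open Literature.Topology.PlaneTopology

namespace Literature.Probability.RandomPlanarGeometry.SAW.YangBaxter

open private eq_of_mem_crossSeg eq_side_of_mem_crossSeg_arcSeg eq_face_of_mem_arcSeg straight_of_mem_arcSeg_arcSeg crossSeg_side_eq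
  lineMap_toC_add_sub_half from Literature.Probability.RandomPlanarGeometry.YangBaxterSAWExcursionJordan

namespace YBWalk

variable {D : Set Face} {a z : MidEdge} {γ : YBWalk D a z} {ta tb : ℕ}

/-- **The closed edges of the kiss loop**: a loop arc segment, a loop crossing segment, or the chord.
[cite: CourantRobbins1958, Ch. V Appendix §2 (polygons)] -/
theorem mem_kEdge_cases (hab : ta < tb) (htb : tb < γ.arcs.length) (hkiss : γ.fc tb = γ.fc ta) {k : ℕ} (hk : k < kN ta tb)
    {x : ℂ} (hx : x ∈ γ.kEdge ta tb k) :
    (∃ i, ta + i < tb ∧ x ∈ arcSeg (γ.fc (ta + i)) (γ.sIn (ta + i)) (γ.sOut (ta + i))) ∨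
      (∃ i, ta + i + 1 ≤ tb ∧ x ∈ crossSeg (γ.nth (ta + i + 1))) ∨
      x ∈ arcSeg (γ.fc ta) (γ.sIn tb) (γ.sIn ta) := by
  rw [kN] at hk
  obtain ⟨i, rfl | rfl⟩ : ∃ i, k = 2 * i ∨ k = 2 * i + 1 := ⟨k / 2, by omega⟩
  · by_cases hi : ta + i < tb
    · exact Or.inl ⟨i, hi, by rwa [kEdge_arc hi] at hx⟩
    · have : i = tb - ta := by omega
      subst this
      exact Or.inr (Or.inr (by rwa [kEdge_chord hab hkiss] at hx))
  · exact Or.inr (Or.inl ⟨i, by omega, by rwa [kEdge_cross (by omega) htb] at hx⟩)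

/-- The four sides of a kiss plaquette: the two arcs use disjoint pairs of sides, so every side is one of the four.
[cite: GlazmanManolescu2019, §1, Fig. 1 (the configurations `w₁`, `w₂`)] -/
theorem side_mem_of_kiss (hta : ta < γ.arcs.length) (htb : tb < γ.arcs.length) (hne : ta ≠ tb) (hkiss : γ.fc tb = γ.fc ta)
    (s : Side) : s = γ.sIn ta ∨ s = γ.sOut ta ∨ s = γ.sIn tb ∨ s = γ.sOut tb := by
  obtain ⟨h0, h1, h2, h3, h4⟩ := γ.not_straight_of_two_arcs hta htb hne hkiss
  have h5 := (γ.side_sIn_nth hta).2.2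
  have h6 := (γ.side_sIn_nth htb).2.2
  revert h1 h2 h3 h4 h5 h6
  cases γ.sIn ta <;> cases γ.sOut ta <;> cases γ.sIn tb <;> cases γ.sOut tb <;> cases s <;> decide

/-- ★ **An arc BEFORE the kiss loop misses it.** For `j < ta` the arc segment of the arc `j` misses every closed edge of the kiss loop — even when the arc `j`
lies in a loop plaquette (an earlier kiss: the two arcs of one plaquette are the disjoint complementary diagonals); a third arc in the kiss plaquette is
impossible. [cite: CourantRobbins1958, Ch. V Appendix §2 (polygons)] [cite: GlazmanManolescu2019, §1, Fig. 1 (the configurations `w₁`, `w₂`)] -/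
theorem arcSeg_disjoint_kEdge_of_lt (hab : ta < tb) (htb : tb < γ.arcs.length) (hkiss : γ.fc tb = γ.fc ta)
    {j : ℕ} (hj : j < ta) {k : ℕ} (hk : k < kN ta tb) {x : ℂ}
    (hxj : x ∈ arcSeg (γ.fc j) (γ.sIn j) (γ.sOut j)) (hxk : x ∈ γ.kEdge ta tb k) : False := by
  have hjn : j < γ.arcs.length := by omega
  rcases mem_kEdge_cases hab htb hkiss hk hxk with ⟨i, hi, ha⟩ | ⟨i, hi, hc⟩ | hch
  · have hF := eq_face_of_mem_arcSeg hxj ha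
    obtain ⟨h0, h1, h2, h3, h4⟩ := γ.not_straight_of_two_arcs (show ta + i < γ.arcs.length by omega) hjn (by omega) hF
    rw [hF] at hxj
    have := straight_of_mem_arcSeg_arcSeg ha hxj (Ne.symm h1) (Ne.symm h3) (Ne.symm h2) (Ne.symm h4)
      (γ.side_sIn_nth (show ta + i < γ.arcs.length by omega)).2.2 (γ.side_sIn_nth hjn).2.2
    exact h0 this
  · obtain ⟨h1, h2, -⟩ := γ.side_sIn_nth hjn
    rcases eq_side_of_mem_crossSeg_arcSeg hc hxj with e | e
    · rw [h1] at e; have := γ.nth_inj (by omega) (by omega) e; omega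
    · rw [h2] at e; have := γ.nth_inj (by omega) (by omega) e; omega
  · have hF := eq_face_of_mem_arcSeg hxj hch
    obtain ⟨-, h1, h2, -, -⟩ := γ.not_straight_of_two_arcs (show ta < γ.arcs.length by omega) hjn (by omega) hF
    obtain ⟨-, h1', h2', -, -⟩ := γ.not_straight_of_two_arcs htb hjn (by omega) (hF.trans hkiss.symm)
    rcases side_mem_of_kiss (show ta < γ.arcs.length by omega) htb (by omega) hkiss (γ.sIn j) with e | e | e | e
    · exact h1 e
    · exact h2 e
    · exact h1' e
    · exact h2' e

/-- ★ **A crossing BEFORE the kiss loop misses it.** For `j ≤ ta` … no: for `1 ≤ j`, `j < ta`∪… precisely for `j < ta` (the crossing `nth j` into the arc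
`j`) and also `j = ta` is EXCLUDED (that crossing ends on the loop); here `j < ta`. [cite: CourantRobbins1958, Ch. V Appendix §2 (polygons)] -/
theorem crossSeg_disjoint_kEdge_of_lt (hab : ta < tb) (htb : tb < γ.arcs.length) (hkiss : γ.fc tb = γ.fc ta)
    {j : ℕ} (hj : j < ta) {k : ℕ} (hk : k < kN ta tb) {x : ℂ}
    (hxj : x ∈ crossSeg (γ.nth j)) (hxk : x ∈ γ.kEdge ta tb k) : False := by
  rcases mem_kEdge_cases hab htb hkiss hk hxk with ⟨i, hi, ha⟩ | ⟨i, hi, hc⟩ | hch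
  · obtain ⟨h1, h2, -⟩ := γ.side_sIn_nth (show ta + i < γ.arcs.length by omega)
    rcases eq_side_of_mem_crossSeg_arcSeg hxj ha with e | e
    · rw [h1] at e; have := γ.nth_inj (by omega) (by omega) e; omega
    · rw [h2] at e; have := γ.nth_inj (by omega) (by omega) e; omega
  · have := γ.nth_inj (by omega) (by omega) (eq_of_mem_crossSeg hxj hc); omega
  · obtain ⟨h1, -, -⟩ := γ.side_sIn_nth (show ta < γ.arcs.length by omega)
    obtain ⟨h1', -, -⟩ := γ.side_sIn_nth htb
    rcases eq_side_of_mem_crossSeg_arcSeg hxj hch with e | e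
    · rw [hkiss] at h1'; rw [h1'] at e; have := γ.nth_inj (by omega) (by omega) e; omega
    · rw [h1] at e; have := γ.nth_inj (by omega) (by omega) e; omega

/-- ★ **An arc AFTER the kiss loop misses it** — including the second visits of loop plaquettes (the two arcs of a doubly visited plaquette are the disjoint
complementary diagonals) and excluding a third visit of the kiss plaquette (its four sides are used up). For `tb < j`.
[cite: CourantRobbins1958, Ch. V Appendix §2 (polygons)] [cite: GlazmanManolescu2019, §1, Fig. 1 (the configurations `w₁`, `w₂`)] -/
theorem arcSeg_disjoint_kEdge_of_gt (hab : ta < tb) (htb : tb < γ.arcs.length) (hkiss : γ.fc tb = γ.fc ta)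
    {j : ℕ} (hj : tb < j) (hjn : j < γ.arcs.length) {k : ℕ} (hk : k < kN ta tb) {x : ℂ}
    (hxj : x ∈ arcSeg (γ.fc j) (γ.sIn j) (γ.sOut j)) (hxk : x ∈ γ.kEdge ta tb k) : False := by
  rcases mem_kEdge_cases hab htb hkiss hk hxk with ⟨i, hi, ha⟩ | ⟨i, hi, hc⟩ | hch
  · -- same face ⇒ a (non-crossing) second visit: the two arcs are disjoint
    have hF := eq_face_of_mem_arcSeg hxj ha
    obtain ⟨h0, h1, h2, h3, h4⟩ := γ.not_straight_of_two_arcs (show ta + i < γ.arcs.length by omega) hjn (by omega) hF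
    rw [hF] at hxj
    have := straight_of_mem_arcSeg_arcSeg ha hxj (Ne.symm h1) (Ne.symm h3) (Ne.symm h2) (Ne.symm h4)
      (γ.side_sIn_nth (show ta + i < γ.arcs.length by omega)).2.2 (γ.side_sIn_nth hjn).2.2
    exact h0 this
  · obtain ⟨h1, h2, -⟩ := γ.side_sIn_nth hjn
    rcases eq_side_of_mem_crossSeg_arcSeg hc hxj with e | e
    · rw [h1] at e; have := γ.nth_inj (by omega) (by omega) e; omega
    · rw [h2] at e; have := γ.nth_inj (by omega) (by omega) e; omega
  · -- a third arc in the kiss plaquette: impossible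
    have hF := eq_face_of_mem_arcSeg hxj hch
    obtain ⟨-, h1, h2, -, -⟩ := γ.not_straight_of_two_arcs (show ta < γ.arcs.length by omega) hjn (by omega) hF
    obtain ⟨-, h1', h2', -, -⟩ := γ.not_straight_of_two_arcs htb hjn (by omega) (hF.trans hkiss.symm)
    rcases side_mem_of_kiss (show ta < γ.arcs.length by omega) htb (by omega) hkiss (γ.sIn j) with e | e | e | e
    · exact h1 e
    · exact h2 e
    · exact h1' e
    · exact h2' e

/-- ★ **A crossing AFTER the kiss loop misses it**: for `tb + 1 ≤ j ≤ n` (the exit crossing of the second visit included).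
[cite: CourantRobbins1958, Ch. V Appendix §2 (polygons)] -/
theorem crossSeg_disjoint_kEdge_of_gt (hab : ta < tb) (htb : tb < γ.arcs.length) (hkiss : γ.fc tb = γ.fc ta)
    {j : ℕ} (hj : tb < j) (hjn : j ≤ γ.arcs.length) {k : ℕ} (hk : k < kN ta tb) {x : ℂ}
    (hxj : x ∈ crossSeg (γ.nth j)) (hxk : x ∈ γ.kEdge ta tb k) : False := by
  rcases mem_kEdge_cases hab htb hkiss hk hxk with ⟨i, hi, ha⟩ | ⟨i, hi, hc⟩ | hch
  · obtain ⟨h1, h2, -⟩ := γ.side_sIn_nth (show ta + i < γ.arcs.length by omega)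
    rcases eq_side_of_mem_crossSeg_arcSeg hxj ha with e | e
    · rw [h1] at e; have := γ.nth_inj (by omega) (by omega) e; omega
    · rw [h2] at e; have := γ.nth_inj (by omega) (by omega) e; omega
  · have := γ.nth_inj (by omega) (by omega) (eq_of_mem_crossSeg hxj hc); omega
  · obtain ⟨h1, -, -⟩ := γ.side_sIn_nth (show ta < γ.arcs.length by omega)
    obtain ⟨h1', -, -⟩ := γ.side_sIn_nth htb
    rcases eq_side_of_mem_crossSeg_arcSeg hxj hch with e | e
    · rw [hkiss] at h1'; rw [h1'] at e; have := γ.nth_inj (by omega) (by omega) e; omega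
    · rw [h1] at e; have := γ.nth_inj (by omega) (by omega) e; omega

/-! ## §2 The drawn pieces of the walk outside the loop -/

/-- The polyline segment between consecutive arcs is the crossing segment of the mid-edge between them.
[cite: GlazmanManolescu2019, §1, Fig. 1 (arcs join mid-edges)] -/
theorem segment_ptOut_ptIn {j : ℕ} (hj : j + 1 < γ.arcs.length) :
    segment ℝ (toC (γ.ptOut j)) (toC (γ.ptIn (j + 1))) = crossSeg (γ.nth (j + 1)) := by
  rw [YBWalk.ptIn, YBWalk.ptOut]
  obtain ⟨-, hout, -⟩ := γ.side_sIn_nth (i := j) (by omega)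
  obtain ⟨hin, -, -⟩ := γ.side_sIn_nth (i := j + 1) hj
  have hface : γ.fc j ≠ γ.fc (j + 1) := γ.fc_succ_ne hj
  rw [← hout, crossSeg_side_eq, innerPt_eq (γ.fc (j + 1)), hin, ← hout,
    nIn_eq_neg_of_side_eq (hout.trans hin.symm) hface, sub_eq_add_neg]

/-- The initial half-crossing from the start mid-edge to the first entry inner point lies on the crossing segment of the start mid-edge.
[cite: GlazmanManolescu2019, §1, Fig. 1] -/
theorem segment_start_subset (hn : 0 < γ.arcs.length) :
    segment ℝ (toC (midPt a)) (toC (γ.ptIn 0)) ⊆ crossSeg (γ.nth 0) := by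
  obtain ⟨hin, -, -⟩ := γ.side_sIn_nth (i := 0) hn
  have em : midPt a = midPt ((γ.fc 0).side (γ.sIn 0)) := by rw [hin, γ.nth_zero]
  rw [← hin, em, YBWalk.ptIn, crossSeg_side_eq, innerPt_eq, segment_symm]
  refine (convex_segment _ _).segment_subset (left_mem_segment _ _ _) ?_
  rw [segment_eq_image_lineMap]
  exact ⟨1 / 2, ⟨by norm_num, by norm_num⟩, lineMap_toC_add_sub_half _ _⟩

/-- The final half-crossing from the last exit inner point to the end mid-edge lies on the crossing segment of the end mid-edge.
[cite: GlazmanManolescu2019, §1, Fig. 1] -/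
theorem segment_end_subset (hn : 0 < γ.arcs.length) :
    segment ℝ (toC (γ.ptOut (γ.arcs.length - 1))) (toC (midPt z)) ⊆ crossSeg (γ.nth γ.arcs.length) := by
  obtain ⟨-, hout, -⟩ := γ.side_sIn_nth (i := γ.arcs.length - 1) (by omega)
  rw [show γ.arcs.length - 1 + 1 = γ.arcs.length by omega] at hout
  have em : midPt z = midPt ((γ.fc (γ.arcs.length - 1)).side (γ.sOut (γ.arcs.length - 1))) := by
    rw [hout, γ.nth_length]
  rw [← hout, em, YBWalk.ptOut, crossSeg_side_eq, innerPt_eq]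
  refine (convex_segment _ _).segment_subset (left_mem_segment _ _ _) ?_
  rw [segment_eq_image_lineMap]
  exact ⟨1 / 2, ⟨by norm_num, by norm_num⟩, lineMap_toC_add_sub_half _ _⟩

/-! ## §3 The winding number of the kiss loop is constant along the before-part and along the after-part -/

/-- ★★ **Before the loop**: for every `j < ta` the winding number of the kiss loop at the entry and exit
inner points of the arc `j` equals its value at the start mid-point. [cite: AhlforsCA1979, Ch. 4 §2.1] [cite: CourantRobbins1958, Ch. V Appendix §2] -/
theorem windK_before (hab : ta < tb) (htb : tb < γ.arcs.length) (hkiss : γ.fc tb = γ.fc ta) :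
    ∀ j, j < ta → γ.windK ta tb (toC (γ.ptIn j)) = γ.windK ta tb (toC (midPt a)) ∧
      γ.windK ta tb (toC (γ.ptOut j)) = γ.windK ta tb (toC (midPt a)) := by
  intro j hj
  induction j with
  | zero =>
    have h1 : γ.windK ta tb (toC (γ.ptIn 0)) = γ.windK ta tb (toC (midPt a)) :=
      (windK_eq_of_segment fun x hx k hk hxk =>
        crossSeg_disjoint_kEdge_of_lt hab htb hkiss (j := 0) hj hk (segment_start_subset (by omega) hx) hxk).symm
    refine ⟨h1, ?_⟩
    rw [← h1]
    exact (windK_eq_of_segment fun x hx k hk hxk =>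
      arcSeg_disjoint_kEdge_of_lt hab htb hkiss (j := 0) hj hk (by rwa [arcSeg, ← YBWalk.ptIn, ← YBWalk.ptOut]) hxk).symm
  | succ j ih =>
    obtain ⟨-, ih2⟩ := ih (by omega)
    have h1 : γ.windK ta tb (toC (γ.ptIn (j + 1))) = γ.windK ta tb (toC (midPt a)) := by
      rw [← ih2]
      exact (windK_eq_of_segment fun x hx k hk hxk =>
        crossSeg_disjoint_kEdge_of_lt hab htb hkiss (j := j + 1) hj hk (by rwa [segment_ptOut_ptIn (by omega)] at hx) hxk).symm
    refine ⟨h1, ?_⟩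
    rw [← h1]
    exact (windK_eq_of_segment fun x hx k hk hxk =>
      arcSeg_disjoint_kEdge_of_lt hab htb hkiss (j := j + 1) hj hk (by rwa [arcSeg, ← YBWalk.ptIn, ← YBWalk.ptOut]) hxk).symm

/-- ★★ **After the loop**: for every `j > tb` the winding number of the kiss loop at the entry and exit inner points of the arc `j` equals its value at the
exit inner point of the second visit `ptOut tb`. [cite: AhlforsCA1979, Ch. 4 §2.1] [cite: CourantRobbins1958, Ch. V Appendix §2] -/
theorem windK_after (hab : ta < tb) (htb : tb < γ.arcs.length) (hkiss : γ.fc tb = γ.fc ta) :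
    ∀ j, tb < j → j < γ.arcs.length → γ.windK ta tb (toC (γ.ptIn j)) = γ.windK ta tb (toC (γ.ptOut tb)) ∧
      γ.windK ta tb (toC (γ.ptOut j)) = γ.windK ta tb (toC (γ.ptOut tb)) := by
  intro j hj hjn
  induction j with
  | zero => omega
  | succ j ih =>
    have h1 : γ.windK ta tb (toC (γ.ptIn (j + 1))) = γ.windK ta tb (toC (γ.ptOut tb)) := by
      have hprev : γ.windK ta tb (toC (γ.ptOut j)) = γ.windK ta tb (toC (γ.ptOut tb)) := by
        rcases Nat.lt_or_ge tb j with hlt | hge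
        · exact (ih hlt (by omega)).2
        · have : j = tb := by omega
          rw [this]
      rw [← hprev]
      exact (windK_eq_of_segment fun x hx k hk hxk =>
        crossSeg_disjoint_kEdge_of_gt hab htb hkiss (j := j + 1) (by omega) (by omega) hk
          (by rwa [segment_ptOut_ptIn hjn] at hx) hxk).symm
    refine ⟨h1, ?_⟩
    rw [← h1]
    exact (windK_eq_of_segment fun x hx k hk hxk =>
      arcSeg_disjoint_kEdge_of_gt hab htb hkiss (j := j + 1) hj hjn hk (by rwa [arcSeg, ← YBWalk.ptIn, ← YBWalk.ptOut]) hxk).symm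

/-- ★★ **At the end point**: the winding number of the kiss loop at the end mid-point `midPt z` equals its value at `ptOut tb`.
[cite: AhlforsCA1979, Ch. 4 §2.1] [cite: CourantRobbins1958, Ch. V Appendix §2] -/
theorem windK_end (hab : ta < tb) (htb : tb < γ.arcs.length) (hkiss : γ.fc tb = γ.fc ta) :
    γ.windK ta tb (toC (midPt z)) = γ.windK ta tb (toC (γ.ptOut tb)) := by
  have hlast : γ.windK ta tb (toC (γ.ptOut (γ.arcs.length - 1))) = γ.windK ta tb (toC (γ.ptOut tb)) := by
    rcases Nat.lt_or_ge tb (γ.arcs.length - 1) with hlt | hge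
    · exact (windK_after hab htb hkiss _ hlt (by omega)).2
    · have : γ.arcs.length - 1 = tb := by omega
      rw [this]
  rw [← hlast]
  exact (windK_eq_of_segment fun x hx k hk hxk =>
    crossSeg_disjoint_kEdge_of_gt hab htb hkiss (j := γ.arcs.length) (by omega) le_rfl hk (segment_end_subset (by omega) hx) hxk).symm

end YBWalk

end Literature.Probability.RandomPlanarGeometry.SAW.YangBaxter
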